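import Literature.NumberTheory.Sieve.SmoothExpSumCrude
import Literature.NumberTheory.Sieve.SmoothMinorArcsResidues
import Literature.NumberTheory.Sieve.SmoothMinorArcsCounts
import HarnessLib

/-!
# Harper's minor-arc estimate for exponential sums over smooth numbers (Theorem 1 of Harper 2016)

Topic `Literature/NumberTheory/Sieve`; a PROVED file toward
`Literature.NumberTheory.DiophantineGeometry.XYZUpperHalf` ([Harper2016, Cor. 1]). We assemble
the proof of Theorem 1 of op. cit. (§3) from the Cauchy–Schwarz reduction
(`norm_sum_smooth_fourierChar_le`), the residue split (`sum_sum_geomBound_residue_split`) and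
the counting inputs (`card_pairs_modEq_le`, `sum_diagWeight_le`, Proposition 1), with all
smooth-number counts taken at the reference scale `x` (`card_smoothNumbersUpTo_le_model_of_le`),
so that the result is stated with `α = α(x, y)` and `𝓟 = x^α ζ(α, y)/√φ₂(α, y) ≍ Ψ(x, y)`:

* `sum_primes_geomBound_le` — for one dyadic class (`qLy ≤ U ≤ qLy²`, `N = x/U`):
  `∑_{p ≤ y} ∑_{n₁,n₂ ∈ S(y)∩[1,N]} min(U/p + 1, 1/(2‖p(n₁−n₂)(a/q+δ)‖))
     ≤ C (log x)³ y^{1−α} ζ̃² N^{2α} (y q^{1−α} + U (Lq)^{−α})`.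
* `norm_smoothExpSum_le` — **Theorem 1** (our form): for `x ≥ x₀`, `(log x)^4 ≤ y`,
  `log y ≤ (log x)^{1/6}`, `(a, q) = 1`, `L = 2(1 + |δ| x)`, `q² L² y³ ≤ x`:
  `|∑_{n ≤ x, n ∈ S(y)} e(n(a/q + δ))| ≤ C (log x)³ y^{(5/2)(1−α)} (qL)^{−1/2 + (3/2)(1−α)} 𝓟`
  (printed: `≪ Ψ(x,y) √(log x log(u+1)/log y) (qL)^{−1/2+(3/2)(1−α)} (u^{3/2} log L … )`, valid
  for `q² L² y³ ≤ x/4`-type ranges; our losses are powers of `log x` and `y^{O(1−α)}` only).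

## References

* A. J. Harper, Compositio Math. 152 (2016) 1121–1158, Theorem 1 and §3 [Harper2016].
-/

noncomputable section

open Finset Real
open scoped FourierTransform
open Literature.NumberTheory.Sieve.Vinogradov

namespace Literature.NumberTheory.Sieve

/-! ### Small tools -/

/-- `‖ε‖ = |ε|` for `|ε| < 1/2`. [folklore] -/
theorem distInt_eq_abs_of_abs_lt_half {ε : ℝ} (h : |ε| < 1 / 2) : distInt ε = |ε| := by
  unfold distInt
  have : round ε = 0 := by
    rw [round_eq_zero_iff]; constructor <;> linarith [abs_lt.1 h |>.1, abs_lt.1 h |>.2]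
  rw [this, Int.cast_zero, sub_zero]

/-- The number of primes dividing `q ≥ 1` is at most `log₂ q`. [folklore] -/
theorem card_primeFactors_le_log (q : ℕ) : q.primeFactors.card ≤ Nat.log 2 q := by
  rcases Nat.eq_zero_or_pos q with hq | hq
  · subst hq; simp
  apply Nat.le_log_of_pow_le one_lt_two
  calc 2 ^ q.primeFactors.card ≤ ∏ p ∈ q.primeFactors, p := by
        apply Finset.pow_card_le_prod
        intro p hp; exact (Nat.prime_of_mem_primeFactors hp).two_le
    _ ≤ q := Nat.le_of_dvd hq (Nat.prod_primeFactors_dvd q)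

/-- The geometric bound on the zero class is dominated by the diagonal weight:
`min(U/p + 1, 1/(2‖p(n₁−n₂)δ‖)) ≤ (1/p) min(2U, 1/(2|n₁−n₂||δ|))` when `p ≤ U` and
`|p(n₁−n₂)δ| < 1/2`. [cite: Harper2016, §3, p. 12] -/
theorem geomBound_le_diagWeight_div {U δ : ℝ} {p n₁ n₂ : ℕ} (hp : 0 < p) (hpU : (p : ℝ) ≤ U)
    (hε : |(p : ℝ) * ((n₁ : ℝ) - n₂) * δ| < 1 / 2) :
    geomBound (U / p + 1) ((p : ℝ) * ((n₁ : ℝ) - n₂) * δ) ≤ diagWeight U δ n₁ n₂ / p := by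
  have hp0 : (0 : ℝ) < p := by exact_mod_cast hp
  have hU0 : 0 < U := lt_of_lt_of_le hp0 hpU
  have hV : U / p + 1 ≤ 2 * U / p := by
    rw [div_add_one hp0.ne', div_le_div_iff_of_pos_right hp0]; linarith
  unfold diagWeight
  by_cases hcase : n₁ = n₂ ∨ δ = 0
  · rw [if_pos hcase]
    have h0 : (p : ℝ) * ((n₁ : ℝ) - n₂) * δ = 0 := by
      rcases hcase with h | h
      · rw [h, sub_self, mul_zero, zero_mul]
      · rw [h, mul_zero]
    rw [h0, geomBound_zero]
    exact hV
  · rw [if_neg hcase]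
    push Not at hcase
    have hne : (n₁ : ℝ) - n₂ ≠ 0 := by
      intro h; apply hcase.1; exact_mod_cast (sub_eq_zero.mp h)
    have hε0 : (p : ℝ) * ((n₁ : ℝ) - n₂) * δ ≠ 0 := by
      apply mul_ne_zero (mul_ne_zero hp0.ne' hne) hcase.2
    have hd : distInt ((p : ℝ) * ((n₁ : ℝ) - n₂) * δ) = |(p : ℝ) * ((n₁ : ℝ) - n₂) * δ| :=
      distInt_eq_abs_of_abs_lt_half hε
    have hdpos : 0 < distInt ((p : ℝ) * ((n₁ : ℝ) - n₂) * δ) := by rw [hd]; exact abs_pos.mpr hε0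
    rw [le_div_iff₀ hp0]
    apply le_min
    · calc geomBound (U / p + 1) ((p : ℝ) * ((n₁ : ℝ) - n₂) * δ) * p ≤ (U / p + 1) * p :=
            mul_le_mul_of_nonneg_right (geomBound_le _ _) hp0.le
        _ ≤ (2 * U / p) * p := mul_le_mul_of_nonneg_right hV hp0.le
        _ = 2 * U := by field_simp
    · calc geomBound (U / p + 1) ((p : ℝ) * ((n₁ : ℝ) - n₂) * δ) * p
          ≤ (1 / (2 * distInt ((p : ℝ) * ((n₁ : ℝ) - n₂) * δ))) * p :=
            mul_le_mul_of_nonneg_right (geomBound_le_inv _ hdpos) hp0.le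
        _ = 1 / (2 * |(n₁ : ℝ) - n₂| * |δ|) := by
            rw [hd, abs_mul, abs_mul, abs_of_pos hp0]
            field_simp

/-! ### One dyadic class: the sum over primes -/

set_option maxHeartbeats 3000000 in
-- a long assembly with a large context
/-- **The sum over primes for one dyadic class** (Harper §3, (3.2)–(3.3) with Proposition 1).
For `x ≥ x₀`, `(log x)^4 ≤ y`, `log y ≤ (log x)^{1/6}`, `(a, q) = 1`, `L = 2(1+|δ|x)`,
`q²L²y³ ≤ x`, and `qLy ≤ U ≤ qLy²`, `N = x/U`, `S = S(y) ∩ [1, N]`: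
`∑_{p ≤ y} ∑_{n₁,n₂ ∈ S} min(U/p+1, 1/(2‖p(n₁−n₂)(a/q+δ)‖))
   ≤ C (log x)³ y^{1−α} ζ̃² N^{2α} (y q^{1−α} + U (Lq)^{−α})`.
[cite: Harper2016, §3, (3.2)–(3.3) and Proposition 1] -/
theorem sum_primes_geomBound_le :
    ∃ C x₀ : ℝ, 0 < C ∧ ∀ (x : ℝ) (y : ℕ), x₀ ≤ x → Real.log x ^ 4 ≤ y →
      Real.log y ≤ Real.log x ^ (1 / 6 : ℝ) → ∀ (q : ℕ), 0 < q → ∀ (a : ℤ), IsCoprime a (q : ℤ) →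
      ∀ (δ : ℝ), (q : ℝ) ^ 2 * (2 * (1 + |δ| * x)) ^ 2 * (y : ℝ) ^ 3 ≤ x →
      ∀ (U : ℕ), (q : ℝ) * (2 * (1 + |δ| * x)) * y ≤ U →
        (U : ℝ) ≤ (q : ℝ) * (2 * (1 + |δ| * x)) * y * y →
        ∑ p ∈ (Finset.range (y + 1)).filter Nat.Prime,
          ∑ n₁ ∈ Nat.smoothNumbersUpTo ⌊x / (U : ℝ)⌋₊ (y + 1),
          ∑ n₂ ∈ Nat.smoothNumbersUpTo ⌊x / (U : ℝ)⌋₊ (y + 1),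
            geomBound ((U : ℝ) / p + 1) ((p : ℝ) * ((n₁ : ℝ) - n₂) * ((a : ℝ) / q + δ)) ≤
          C * Real.log x ^ 3 * (y : ℝ) ^ (1 - saddlePoint x y) *
            (smoothZeta (saddlePoint x y) y / Real.sqrt (saddlePhi₂ (saddlePoint x y) y)) ^ 2 *
            (x / U) ^ (2 * saddlePoint x y) *
            ((y : ℝ) * (q : ℝ) ^ (1 - saddlePoint x y) +
              (U : ℝ) * ((2 * (1 + |δ| * x)) * q) ^ (-saddlePoint x y)) := by
  classical
  obtain ⟨C_T, x₀T, hC_T, hTmain⟩ := card_pairs_modEq_le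
  obtain ⟨C_E, x₀E, hC_E, hEmain⟩ := sum_diagWeight_le
  obtain ⟨C₂, x₀M, hC₂, hM⟩ := card_smoothNumbersUpTo_le_model_of_le
  obtain ⟨x₀F, h35⟩ := three_fifths_le_saddlePoint
  obtain ⟨x₀1, hlt1⟩ := saddlePoint_lt_one
  set X : ℝ := max (max (max x₀T x₀E) (max x₀M x₀F)) (max x₀1 (Real.exp 16)) with hXdef
  refine ⟨4 * C_T * C₂ + 8 * C_E * C₂, X, by positivity,
    fun x y hx hy4 hy6 q hq a hcop δ hH U hUlo hUhi => ?_⟩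
  have hx₀T : x₀T ≤ x := le_trans (((le_max_left _ _).trans (le_max_left _ _)).trans (le_max_left _ _)) hx
  have hx₀E : x₀E ≤ x := le_trans (((le_max_right _ _).trans (le_max_left _ _)).trans (le_max_left _ _)) hx
  have hx₀M : x₀M ≤ x := le_trans (((le_max_left _ _).trans (le_max_right _ _)).trans (le_max_left _ _)) hx
  have hx₀F : x₀F ≤ x := le_trans (((le_max_right _ _).trans (le_max_right _ _)).trans (le_max_left _ _)) hx
  have hx₀1 : x₀1 ≤ x := le_trans ((le_max_left _ _).trans (le_max_right _ _)) hx
  have hxe : Real.exp 16 ≤ x := le_trans ((le_max_right _ _).trans (le_max_right _ _)) hx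
  ------------------------------------------------------------------
  -- ### the range
  set Lx := Real.log x with hLx
  have hLx16 : 16 ≤ Lx := by
    have := Real.log_le_log (Real.exp_pos _) hxe; rwa [Real.log_exp] at this
  have hx16 : (16 : ℝ) ≤ x := by
    have h1 : (16 : ℝ) ≤ Real.exp 16 := by have := Real.add_one_le_exp (16 : ℝ); linarith
    exact h1.trans hxe
  have hx1 : 1 < x := by linarith
  have hx0 : 0 < x := by linarith
  have hLx1 : 1 ≤ Lx := by linarith
  have hyL : Lx ≤ y := by
    calc Lx = Lx ^ 1 := (pow_one _).symm
      _ ≤ Lx ^ 4 := pow_le_pow_right₀ hLx1 (by norm_num)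
      _ ≤ y := hy4
  have hy16 : (16 : ℝ) ≤ y := by linarith
  have hy0 : (0 : ℝ) < y := by linarith
  have hy1 : (1 : ℝ) ≤ y := by linarith
  set ℓ := Real.log y with hℓ
  have hℓ0 : 0 < ℓ := Real.log_pos (by linarith)
  have hℓLx : ℓ ≤ Lx := by
    refine hy6.trans ?_
    calc Lx ^ (1 / 6 : ℝ) ≤ Lx ^ (1 : ℝ) := Real.rpow_le_rpow_of_exponent_le hLx1 (by norm_num)
      _ = Lx := Real.rpow_one _
  have hyx : (y : ℝ) ≤ x := by
    rw [← Real.exp_log hy0, ← Real.exp_log hx0]; exact Real.exp_le_exp.mpr hℓLx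
  have hy3 : Real.log x ^ 3 ≤ y := le_trans (pow_le_pow_right₀ hLx1 (by norm_num)) hy4
  set α := saddlePoint x y with hαdef
  have hα35 : 3 / 5 ≤ α := h35 x y hx₀F hy3 hyx
  have hα0 : 0 < α := by linarith
  have hα1 : α ≤ 1 := (hlt1 x y hx₀1 hy3 hyx hy6).le
  set ζt := smoothZeta α y / Real.sqrt (saddlePhi₂ α y) with hζt
  have hζt0 : 0 ≤ ζt := div_nonneg (smoothZeta_pos hα0).le (Real.sqrt_nonneg _)
  ------------------------------------------------------------------
  -- ### parameters
  set L := 2 * (1 + |δ| * x) with hL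
  have hδx0 : 0 ≤ |δ| * x := by positivity
  have hL2 : 2 ≤ L := by rw [hL]; linarith
  have hL0 : 0 < L := by linarith
  have hq1 : (1 : ℝ) ≤ q := by exact_mod_cast hq
  have hq0 : (0 : ℝ) < q := by linarith
  set W := (q : ℝ) * L * y with hW
  have hW32 : 32 ≤ W := by
    rw [hW]
    calc (32 : ℝ) = 1 * 2 * 16 := by norm_num
      _ ≤ q * L * y := by gcongr
  have hW0 : 0 < W := by linarith
  have hU0 : (0 : ℝ) < U := by linarith
  have hU16 : (16 : ℝ) ≤ U := by linarith
  set N := x / (U : ℝ) with hN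
  have hN0 : 0 < N := by positivity
  -- `q² L² y³ ≤ x` rewritten
  have hH' : W * (W * y) = (q : ℝ) ^ 2 * L ^ 2 * (y : ℝ) ^ 3 := by rw [hW]; ring
  have hH2 : W * (W * y) ≤ x := by rw [hH']; exact hH
  have hWN : W ≤ N := by
    -- `N = x/U ≥ x/(W y) ≥ W`
    rw [hN, le_div_iff₀ hU0]
    calc W * U ≤ W * (W * y) := by gcongr
      _ ≤ x := hH2
  have hN1 : 1 ≤ N := by linarith
  have hNx : N ≤ x := by
    rw [hN]; exact div_le_self hx0.le (by linarith)
  have hqx : (q : ℝ) ≤ x := by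
    have h1 : (q : ℝ) ≤ W := by
      rw [hW]; calc (q : ℝ) = q * 1 * 1 := by ring
        _ ≤ q * L * y := by (gcongr; linarith)
    have h2 : W ≤ W * (W * y) := by
      have : 1 ≤ W * y := by nlinarith
      nlinarith
    linarith
  have hLxW : L ≤ x := by
    have h1 : L ≤ W := by
      rw [hW]; calc L = 1 * L * 1 := by ring
        _ ≤ q * L * y := by gcongr
    have h2 : W ≤ W * (W * y) := by
      have : 1 ≤ W * y := by nlinarith
      nlinarith
    linarith
  -- the smooth numbers up to `N`
  set S := Nat.smoothNumbersUpTo ⌊N⌋₊ (y + 1) with hS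
  have hSmem : ∀ n ∈ S, 1 ≤ n ∧ (n : ℝ) ≤ N := by
    intro n hn
    rw [hS, Nat.mem_smoothNumbersUpTo] at hn
    exact ⟨Nat.pos_of_ne_zero hn.2.1, le_trans (by exact_mod_cast hn.1) (Nat.floor_le hN0.le)⟩
  have hScard : (S.card : ℝ) ≤ C₂ * N ^ α * ζt := by
    have := hM x y hx₀M hy4 hy6 N hN1 hNx
    rw [← hαdef, ← hS] at this
    calc (S.card : ℝ) ≤ C₂ * (N ^ α * smoothZeta α y / Real.sqrt (saddlePhi₂ α y)) := this
      _ = C₂ * N ^ α * ζt := by rw [hζt]; ring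
  -- primes
  set P := (Finset.range (y + 1)).filter Nat.Prime with hP
  have hPmem : ∀ p ∈ P, p.Prime ∧ (p : ℝ) ≤ y := by
    intro p hp
    rw [hP, Finset.mem_filter, Finset.mem_range] at hp
    exact ⟨hp.2, by exact_mod_cast Nat.lt_succ_iff.mp hp.1⟩
  have hPcard : (P.card : ℝ) ≤ y := by
    have : P ⊆ Finset.Icc 2 y := by
      intro p hp
      rw [hP, Finset.mem_filter, Finset.mem_range] at hp
      rw [Finset.mem_Icc]; exact ⟨hp.2.two_le, by omega⟩
    have h := Finset.card_le_card this
    rw [Nat.card_Icc] at h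
    have : ((P.card : ℕ) : ℝ) ≤ ((y + 1 - 2 : ℕ) : ℝ) := by exact_mod_cast h
    refine this.trans ?_
    rcases Nat.lt_or_ge y 1 with h1 | h1
    · simp at h1; subst h1; simp
    · rw [Nat.cast_sub (by omega)]; push_cast; linarith
  ------------------------------------------------------------------
  -- ### the uniform per-prime bounds
  set OD : ℝ := 2 * (C_T * ℓ * (y : ℝ) ^ (1 - α) * ζt) * S.card * N ^ α * (q : ℝ) ^ (1 - α) *
    (1 + Real.log q) with hOD
  set Estar : ℝ := C_E * (1 + Real.log L) * U * S.card * (ℓ * (y : ℝ) ^ (1 - α) *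
    (N / (L * q)) ^ α * ζt) with hEstar
  have hOD0 : 0 ≤ OD := by
    have : 0 ≤ Real.log (q : ℝ) := Real.log_nonneg hq1
    positivity
  have hEstar0 : 0 ≤ Estar := by
    have : 0 ≤ Real.log L := Real.log_nonneg (by linarith)
    positivity
  have hper : ∀ p ∈ P, ∑ n₁ ∈ S, ∑ n₂ ∈ S,
      geomBound ((U : ℝ) / p + 1) ((p : ℝ) * ((n₁ : ℝ) - n₂) * ((a : ℝ) / q + δ)) ≤
        OD + (if p ∣ q then 1 else 1 / (p : ℝ)) * Estar := by
    intro p hp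
    obtain ⟨hpP, hpy⟩ := hPmem p hp
    have hp0 : 0 < p := hpP.pos
    have hp0r : (0 : ℝ) < p := by exact_mod_cast hp0
    have hpU : (p : ℝ) ≤ U := by
      have : (y : ℝ) ≤ W := by
        rw [hW]; calc (y : ℝ) = 1 * 1 * y := by ring
          _ ≤ q * L * y := by (gcongr; linarith)
      linarith
    -- `r = q / gcd(p, q)`, `a' = (p / gcd) a`
    set g := Nat.gcd p q with hg
    have hg0 : 0 < g := Nat.gcd_pos_of_pos_right p hq
    have hgp : g ∣ p := Nat.gcd_dvd_left p q
    have hgq : g ∣ q := Nat.gcd_dvd_right p q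
    set r := q / g with hr
    set p' := p / g with hp'
    have hr0 : 0 < r := Nat.div_pos (Nat.le_of_dvd hq hgq) hg0
    have hr0r : (0 : ℝ) < r := by exact_mod_cast hr0
    have hqrg : q = r * g := (Nat.div_mul_cancel hgq).symm
    have hprg : p = p' * g := (Nat.div_mul_cancel hgp).symm
    have hrq : (r : ℝ) ≤ q := by exact_mod_cast Nat.div_le_self q g
    have hr_dvd : r ∣ q := Dvd.intro _ hqrg.symm
    have hgp_le : (g : ℝ) ≤ p := by exact_mod_cast Nat.le_of_dvd hp0 hgp
    have hqrp : (q : ℝ) ≤ r * p := by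
      calc (q : ℝ) = r * g := by exact_mod_cast hqrg
        _ ≤ r * p := by gcongr
    have hpq : (p : ℝ) / q = p' / r := by
      rw [div_eq_div_iff hq0.ne' hr0r.ne']
      have : (p : ℝ) * r = p' * q := by
        rw [hqrg, hprg]; push_cast; ring
      linarith
    have hcop' : IsCoprime ((p' : ℤ) * a) (r : ℤ) := by
      apply IsCoprime.mul_left
      · rw [Nat.isCoprime_iff_coprime, hp', hr, hg]
        exact Nat.coprime_div_gcd_div_gcd hg0
      · exact IsCoprime.of_isCoprime_of_dvd_right hcop (by exact_mod_cast hr_dvd)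
    -- the phase identity
    set ε : ℕ → ℕ → ℝ := fun n₁ n₂ => (p : ℝ) * ((n₁ : ℝ) - n₂) * δ with hε
    have hphase : ∀ n₁ n₂ : ℕ, (p : ℝ) * ((n₁ : ℝ) - n₂) * ((a : ℝ) / q + δ) =
        (((p' : ℤ) * a : ℤ) : ℝ) * ((n₁ : ℝ) - n₂) / r + ε n₁ n₂ := by
      intro n₁ n₂
      have : (p : ℝ) * ((a : ℝ) / q) = (((p' : ℤ) * a : ℤ) : ℝ) / r := by
        push_cast
        rw [mul_div_assoc', mul_comm (p : ℝ), mul_div_assoc, hpq]; ring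
      simp only [hε]
      calc (p : ℝ) * ((n₁ : ℝ) - n₂) * ((a : ℝ) / q + δ)
          = ((p : ℝ) * ((a : ℝ) / q)) * ((n₁ : ℝ) - n₂) + (p : ℝ) * ((n₁ : ℝ) - n₂) * δ := by ring
        _ = _ := by rw [this]; ring
    -- `|ε| < 1/(2q) ≤ 1/(2r)`
    have hεbd : ∀ n₁ ∈ S, ∀ n₂ ∈ S, |ε n₁ n₂| < 1 / (2 * (q : ℝ)) := by
      intro n₁ hn₁ n₂ hn₂
      obtain ⟨h11, h1N⟩ := hSmem n₁ hn₁
      obtain ⟨h21, h2N⟩ := hSmem n₂ hn₂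
      have h11' : (1 : ℝ) ≤ n₁ := by exact_mod_cast h11
      have h21' : (1 : ℝ) ≤ n₂ := by exact_mod_cast h21
      have hdiff : |(n₁ : ℝ) - n₂| ≤ N := by rw [abs_le]; constructor <;> linarith
      simp only [hε]
      rw [abs_mul, abs_mul, abs_of_pos hp0r]
      -- `p |n₁ - n₂| |δ| ≤ y N |δ| ≤ x |δ| / (q L) < 1/(2q)`
      have h1 : (p : ℝ) * |(n₁ : ℝ) - n₂| * |δ| ≤ y * N * |δ| := by gcongr
      have h2 : (y : ℝ) * N ≤ x / (q * L) := by
        rw [hN, le_div_iff₀ (by positivity)]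
        calc (y : ℝ) * (x / U) * (q * L) = x * (W / U) := by rw [hW]; field_simp
          _ ≤ x * 1 := by gcongr; rw [div_le_one hU0]; exact hUlo
          _ = x := mul_one x
      have h3 : x / (q * L) * |δ| < 1 / (2 * q) := by
        rw [div_mul_eq_mul_div, div_lt_div_iff₀ (by positivity) (by positivity)]
        calc x * |δ| * (2 * q) = q * (2 * (|δ| * x)) := by ring
          _ < q * L := by apply mul_lt_mul_of_pos_left _ hq0; rw [hL]; linarith
          _ = 1 * (q * L) := by ring
      calc (p : ℝ) * |(n₁ : ℝ) - n₂| * |δ| ≤ y * N * |δ| := h1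
        _ ≤ x / (q * L) * |δ| := by gcongr
        _ < 1 / (2 * q) := h3
    have hεr : ∀ n₁ ∈ S, ∀ n₂ ∈ S, |ε n₁ n₂| ≤ 1 / (2 * (r : ℝ)) := by
      intro n₁ hn₁ n₂ hn₂
      refine (hεbd n₁ hn₁ n₂ hn₂).le.trans ?_
      exact one_div_le_one_div_of_le (by positivity) (by linarith)
    -- the class counts `T`
    obtain ⟨T, hT⟩ : ∃ T : ℝ, T = S.card * (C_T * ℓ * (N / r) ^ α * (y : ℝ) ^ (1 - α) * ζt) := ⟨_, rfl⟩
    have hKT : 0 ≤ C_T * ℓ * (y : ℝ) ^ (1 - α) * ζt :=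
      mul_nonneg (mul_nonneg (mul_nonneg hC_T.le hℓ0.le) (Real.rpow_nonneg hy0.le _)) hζt0
    have hT0 : 0 ≤ T := by
      rw [hT]
      refine mul_nonneg (Nat.cast_nonneg _) (mul_nonneg (mul_nonneg (mul_nonneg (mul_nonneg hC_T.le hℓ0.le)
        (Real.rpow_nonneg (div_nonneg hN0.le hr0r.le) _)) (Real.rpow_nonneg hy0.le _)) hζt0)
    have hryN : (r : ℝ) * y ≤ N := by
      calc (r : ℝ) * y ≤ q * y := by gcongr
        _ ≤ W := by rw [hW]; calc (q : ℝ) * y = q * 1 * y := by ring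
            _ ≤ q * L * y := by gcongr; linarith
        _ ≤ N := hWN
    have hTb : ∀ b : ℕ, 0 < b → b < r →
        (((S ×ˢ S).filter (fun nn => ((nn.1 : ℤ) - nn.2) % r = b)).card : ℝ) ≤ T := by
      intro b _ hbr
      have key := hTmain x y hx₀T hy4 hy6 r hr0 N hryN hNx (b : ℤ)
      rw [← hαdef, ← hS] at key
      have hbmod : ((b : ℤ)) % (r : ℤ) = b := Int.emod_eq_of_lt (by positivity) (by exact_mod_cast hbr)
      rw [hbmod] at key
      rw [hT, hℓ, hζt]
      convert key using 2
    -- apply the residue split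
    have hsplit := sum_sum_geomBound_residue_split S hr0 hcop' ε hεr (V := (U : ℝ) / p + 1)
      (by positivity) hT0 hTb
    have hLHS : ∑ n₁ ∈ S, ∑ n₂ ∈ S, geomBound ((U : ℝ) / p + 1) ((p : ℝ) * ((n₁ : ℝ) - n₂) * ((a : ℝ) / q + δ)) =
        ∑ n₁ ∈ S, ∑ n₂ ∈ S, geomBound ((U : ℝ) / p + 1)
          ((((p' : ℤ) * a : ℤ) : ℝ) * ((n₁ : ℝ) - n₂) / r + ε n₁ n₂) := by
      refine Finset.sum_congr rfl fun n₁ _ => Finset.sum_congr rfl fun n₂ _ => ?_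
      rw [hphase]
    rw [hLHS]
    refine hsplit.trans (add_le_add ?_ ?_)
    · -- off-diagonal: `2 T r (1 + log r) ≤ OD`
      have hlogr : Real.log r ≤ Real.log q := Real.log_le_log hr0r hrq
      have hlogr0 : 0 ≤ Real.log r := Real.log_nonneg (by exact_mod_cast hr0)
      have hNr : (N / r) ^ α * r ≤ N ^ α * (q : ℝ) ^ (1 - α) := by
        rw [Real.div_rpow hN0.le hr0r.le, div_mul_eq_mul_div, div_le_iff₀ (Real.rpow_pos_of_pos hr0r _)]
        calc N ^ α * r = N ^ α * ((r : ℝ) ^ (1 - α) * (r : ℝ) ^ α) := by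
              rw [← Real.rpow_add hr0r]; norm_num
          _ ≤ N ^ α * ((q : ℝ) ^ (1 - α) * (r : ℝ) ^ α) := by
              apply mul_le_mul_of_nonneg_left _ (Real.rpow_nonneg hN0.le _)
              apply mul_le_mul_of_nonneg_right _ (Real.rpow_nonneg hr0r.le _)
              exact Real.rpow_le_rpow hr0r.le hrq (by linarith)
          _ = N ^ α * (q : ℝ) ^ (1 - α) * (r : ℝ) ^ α := by ring
      have hK2 : 0 ≤ 2 * (C_T * ℓ * (y : ℝ) ^ (1 - α) * ζt) * S.card :=
        mul_nonneg (mul_nonneg (by norm_num) hKT) (Nat.cast_nonneg _)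
      calc 2 * T * r * (1 + Real.log r)
          = 2 * (C_T * ℓ * (y : ℝ) ^ (1 - α) * ζt) * S.card * ((N / r) ^ α * r) * (1 + Real.log r) := by
            rw [hT]; ring
        _ ≤ 2 * (C_T * ℓ * (y : ℝ) ^ (1 - α) * ζt) * S.card * (N ^ α * (q : ℝ) ^ (1 - α)) * (1 + Real.log q) := by
            apply mul_le_mul (mul_le_mul_of_nonneg_left hNr hK2) (by linarith) (by linarith)
            exact mul_nonneg hK2 (mul_nonneg (Real.rpow_nonneg hN0.le _) (Real.rpow_nonneg hq0.le _))
        _ = OD := by rw [hOD]; ring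
    · -- diagonal: `∑ geomBound V ε ≤ (1/p) ∑ diagWeight ≤ c_p Estar`
      have hdiag : ∑ nn ∈ (S ×ˢ S).filter (fun nn => (r : ℤ) ∣ ((nn.1 : ℤ) - nn.2)),
          geomBound ((U : ℝ) / p + 1) (ε nn.1 nn.2) ≤
          (1 / (p : ℝ)) * ∑ nn ∈ (S ×ˢ S).filter (fun nn => (r : ℤ) ∣ ((nn.1 : ℤ) - nn.2)),
            diagWeight (U : ℝ) δ nn.1 nn.2 := by
        rw [Finset.mul_sum]
        refine Finset.sum_le_sum fun nn hnn => ?_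
        have hnnS := (Finset.mem_filter.mp hnn).1
        rw [Finset.mem_product] at hnnS
        have hlt : |ε nn.1 nn.2| < 1 / 2 := by
          refine (hεbd nn.1 hnnS.1 nn.2 hnnS.2).trans_le ?_
          apply one_div_le_one_div_of_le (by norm_num); linarith
        simp only [hε] at hlt ⊢
        rw [one_div_mul_eq_div]
        exact geomBound_le_diagWeight_div hp0 hpU hlt
      have hE := hEmain x y hx₀E hy4 hy6 r hr0 (U : ℝ) δ hU16 (by
        -- `r y L ≤ 2 x / U`
        rw [← hL]
        have h1 : (r : ℝ) * y * L ≤ W := by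
          rw [hW]; calc (r : ℝ) * y * L = r * L * y := by ring
            _ ≤ q * L * y := by gcongr
        have h2 : W * U ≤ x := by
          calc W * U ≤ W * (W * y) := by gcongr
            _ ≤ x := hH2
        have h3 : W ≤ x / U := by rw [le_div_iff₀ hU0]; exact h2
        linarith)
      rw [← hN, ← hL, ← hαdef, ← hS] at hE
      -- `(N/(L r))^α ≤ p^α (N/(L q))^α`, and `= (N/(Lq))^α` when `p ∤ q`
      have hNLr : (N / (L * r)) ^ α ≤ (p : ℝ) ^ α * (N / (L * q)) ^ α := by
        rw [← Real.mul_rpow hp0r.le (by positivity)]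
        apply Real.rpow_le_rpow (by positivity) _ hα0.le
        rw [div_le_iff₀ (by positivity)]
        calc N = p * (N / (L * q)) * (L * (q / p)) := by field_simp
          _ ≤ p * (N / (L * q)) * (L * r) := by
              gcongr
              rw [div_le_iff₀ hp0r]; exact hqrp
      have hcp : (1 / (p : ℝ)) * (N / (L * r)) ^ α ≤
          (if p ∣ q then 1 else 1 / (p : ℝ)) * (N / (L * q)) ^ α := by
        split_ifs with hdvd
        · calc (1 / (p : ℝ)) * (N / (L * r)) ^ α ≤ (1 / (p : ℝ)) * ((p : ℝ) ^ α * (N / (L * q)) ^ α) := by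
                gcongr
            _ = (p : ℝ) ^ (α - 1) * (N / (L * q)) ^ α := by
                rw [Real.rpow_sub_one hp0r.ne']; ring
            _ ≤ 1 * (N / (L * q)) ^ α := by
                gcongr
                exact Real.rpow_le_one_of_one_le_of_nonpos (by exact_mod_cast hp0) (by linarith)
        · -- `gcd(p, q) = 1`, so `r = q`
          have hg1 : g = 1 := by
            rw [hg]; exact Nat.Coprime.gcd_eq_one ((Nat.Prime.coprime_iff_not_dvd hpP).mpr hdvd)
          have hrq' : (r : ℝ) = q := by rw [hr, hg1, Nat.div_one]
          rw [hrq']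
      calc ∑ nn ∈ (S ×ˢ S).filter (fun nn => (r : ℤ) ∣ ((nn.1 : ℤ) - nn.2)),
            geomBound ((U : ℝ) / p + 1) (ε nn.1 nn.2)
          ≤ (1 / (p : ℝ)) * ∑ nn ∈ (S ×ˢ S).filter (fun nn => (r : ℤ) ∣ ((nn.1 : ℤ) - nn.2)),
              diagWeight (U : ℝ) δ nn.1 nn.2 := hdiag
        _ ≤ (1 / (p : ℝ)) * (C_E * (1 + Real.log L) * U * S.card *
              (ℓ * (y : ℝ) ^ (1 - α) * (N / (L * r)) ^ α * ζt)) :=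
            mul_le_mul_of_nonneg_left hE (by positivity)
        _ = (C_E * (1 + Real.log L) * U * S.card * (ℓ * (y : ℝ) ^ (1 - α) * ζt)) *
              ((1 / (p : ℝ)) * (N / (L * r)) ^ α) := by ring
        _ ≤ (C_E * (1 + Real.log L) * U * S.card * (ℓ * (y : ℝ) ^ (1 - α) * ζt)) *
              ((if p ∣ q then 1 else 1 / (p : ℝ)) * (N / (L * q)) ^ α) := by
            apply mul_le_mul_of_nonneg_left hcp
            have hlL : 0 ≤ Real.log L := Real.log_nonneg (by linarith)
            refine mul_nonneg (mul_nonneg (mul_nonneg (mul_nonneg hC_E.le (by linarith)) hU0.le)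
              (Nat.cast_nonneg _)) (mul_nonneg (mul_nonneg hℓ0.le (Real.rpow_nonneg hy0.le _)) hζt0)
        _ = (if p ∣ q then 1 else 1 / (p : ℝ)) * Estar := by rw [hEstar]; ring
  ------------------------------------------------------------------
  -- ### sum over primes
  have hsumc : ∑ p ∈ P, (if p ∣ q then 1 else 1 / (p : ℝ)) ≤ (1 + ℓ) + Nat.log 2 q := by
    have h1 : ∀ p ∈ P, (if p ∣ q then 1 else 1 / (p : ℝ)) ≤ 1 / (p : ℝ) + (if p ∣ q then 1 else 0) := by
      intro p _
      split_ifs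
      · simp
      · simp
    refine (Finset.sum_le_sum h1).trans ?_
    rw [Finset.sum_add_distrib]
    refine add_le_add (by rw [hℓ]; exact sum_primes_inv_le y) ?_
    rw [Finset.sum_boole]
    have hsub : P.filter (fun p => p ∣ q) ⊆ q.primeFactors := by
      intro p hp
      rw [Finset.mem_filter] at hp
      exact Nat.mem_primeFactors.mpr ⟨(hPmem p hp.1).1, hp.2, hq.ne'⟩
    calc (((P.filter (fun p => p ∣ q)).card : ℕ) : ℝ) ≤ q.primeFactors.card := by
          exact_mod_cast Finset.card_le_card hsub
      _ ≤ Nat.log 2 q := by exact_mod_cast card_primeFactors_le_log q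
  have htotal : ∑ p ∈ P, ∑ n₁ ∈ S, ∑ n₂ ∈ S,
      geomBound ((U : ℝ) / p + 1) ((p : ℝ) * ((n₁ : ℝ) - n₂) * ((a : ℝ) / q + δ)) ≤
        y * OD + ((1 + ℓ) + Nat.log 2 q) * Estar := by
    calc ∑ p ∈ P, ∑ n₁ ∈ S, ∑ n₂ ∈ S,
          geomBound ((U : ℝ) / p + 1) ((p : ℝ) * ((n₁ : ℝ) - n₂) * ((a : ℝ) / q + δ))
        ≤ ∑ p ∈ P, (OD + (if p ∣ q then 1 else 1 / (p : ℝ)) * Estar) := Finset.sum_le_sum hper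
      _ = P.card * OD + (∑ p ∈ P, (if p ∣ q then 1 else 1 / (p : ℝ))) * Estar := by
          rw [Finset.sum_add_distrib, Finset.sum_const, nsmul_eq_mul, Finset.sum_mul]
      _ ≤ y * OD + ((1 + ℓ) + Nat.log 2 q) * Estar := by
          gcongr
  ------------------------------------------------------------------
  -- ### logarithms and the final shape
  have hlogq : Real.log q ≤ Lx := by rw [hLx]; exact Real.log_le_log hq0 hqx
  have hlogq0 : 0 ≤ Real.log q := Real.log_nonneg hq1
  have hlogL : Real.log L ≤ Lx := by rw [hLx]; exact Real.log_le_log hL0 hLxW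
  have hlogL0 : 0 ≤ Real.log L := Real.log_nonneg (by linarith)
  have hlog2q : (Nat.log 2 q : ℝ) ≤ 2 * Lx := by
    have h1 : (2 : ℝ) ^ (Nat.log 2 q) ≤ q := by exact_mod_cast Nat.pow_log_le_self 2 hq.ne'
    have h2 : (Nat.log 2 q : ℝ) * Real.log 2 ≤ Real.log q := by
      rw [← Real.log_pow]; exact Real.log_le_log (by positivity) h1
    have hl2 : (1 : ℝ) / 2 < Real.log 2 := by have := Real.log_two_gt_d9; linarith
    nlinarith
  have hNq : N ^ α * (N / (L * q)) ^ α = N ^ (2 * α) * (L * q) ^ (-α) := by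
    rw [Real.div_rpow hN0.le (by positivity), Real.rpow_neg (by positivity), two_mul,
      Real.rpow_add hN0]
    ring
  -- `y · OD ≤ 4 C_T C₂ Lx³ y^{1-α} ζt² N^{2α} · y q^{1-α}`
  have hOD_le : y * OD ≤ (4 * C_T * C₂) * Lx ^ 3 * (y : ℝ) ^ (1 - α) * ζt ^ 2 * N ^ (2 * α) *
      ((y : ℝ) * (q : ℝ) ^ (1 - α)) := by
    have h1 : ℓ * (1 + Real.log q) ≤ 2 * Lx ^ 3 := by
      have e1 : Lx ≤ Lx ^ 3 := by
        calc Lx = Lx ^ 1 := (pow_one _).symm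
          _ ≤ Lx ^ 3 := pow_le_pow_right₀ hLx1 (by norm_num)
      have e2 : Lx ^ 2 ≤ Lx ^ 3 := pow_le_pow_right₀ hLx1 (by norm_num)
      calc ℓ * (1 + Real.log q) ≤ Lx * (1 + Lx) := by gcongr
        _ = Lx + Lx ^ 2 := by ring
        _ ≤ 2 * Lx ^ 3 := by linarith
    have h2 : (S.card : ℝ) * N ^ α ≤ C₂ * ζt * N ^ (2 * α) := by
      calc (S.card : ℝ) * N ^ α ≤ (C₂ * N ^ α * ζt) * N ^ α := by gcongr
        _ = C₂ * ζt * N ^ (2 * α) := by rw [two_mul, Real.rpow_add hN0]; ring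
    calc y * OD = 2 * C_T * (ℓ * (1 + Real.log q)) * ((S.card : ℝ) * N ^ α) *
          ((y : ℝ) ^ (1 - α) * ζt * (y * (q : ℝ) ^ (1 - α))) := by rw [hOD]; ring
      _ ≤ 2 * C_T * (2 * Lx ^ 3) * (C₂ * ζt * N ^ (2 * α)) *
          ((y : ℝ) ^ (1 - α) * ζt * (y * (q : ℝ) ^ (1 - α))) := by gcongr
      _ = _ := by ring
  have hE_le : ((1 + ℓ) + Nat.log 2 q) * Estar ≤ (8 * C_E * C₂) * Lx ^ 3 * (y : ℝ) ^ (1 - α) * ζt ^ 2 *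
      N ^ (2 * α) * ((U : ℝ) * (L * q) ^ (-α)) := by
    have h1 : ((1 + ℓ) + Nat.log 2 q) * ((1 + Real.log L) * ℓ) ≤ 8 * Lx ^ 3 := by
      calc ((1 + ℓ) + Nat.log 2 q) * ((1 + Real.log L) * ℓ) ≤ ((1 + Lx) + 2 * Lx) * ((1 + Lx) * Lx) := by
            gcongr
        _ ≤ (4 * Lx) * ((2 * Lx) * Lx) := by
            have : 1 + Lx ≤ 2 * Lx := by linarith
            have : (1 + Lx) + 2 * Lx ≤ 4 * Lx := by linarith
            gcongr
        _ = 8 * Lx ^ 3 := by ring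
    have h2 : (S.card : ℝ) * (N / (L * q)) ^ α ≤ C₂ * ζt * (N ^ (2 * α) * (L * q) ^ (-α)) := by
      calc (S.card : ℝ) * (N / (L * q)) ^ α ≤ (C₂ * N ^ α * ζt) * (N / (L * q)) ^ α := by gcongr
        _ = C₂ * ζt * (N ^ α * (N / (L * q)) ^ α) := by ring
        _ = _ := by rw [hNq]
    calc ((1 + ℓ) + Nat.log 2 q) * Estar
        = C_E * (((1 + ℓ) + Nat.log 2 q) * ((1 + Real.log L) * ℓ)) * ((S.card : ℝ) * (N / (L * q)) ^ α) *
            ((y : ℝ) ^ (1 - α) * ζt * U) := by rw [hEstar]; ring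
      _ ≤ C_E * (8 * Lx ^ 3) * (C₂ * ζt * (N ^ (2 * α) * (L * q) ^ (-α))) *
            ((y : ℝ) ^ (1 - α) * ζt * U) := by gcongr
      _ = _ := by ring
  calc ∑ p ∈ P, ∑ n₁ ∈ S, ∑ n₂ ∈ S,
        geomBound ((U : ℝ) / p + 1) ((p : ℝ) * ((n₁ : ℝ) - n₂) * ((a : ℝ) / q + δ))
      ≤ y * OD + ((1 + ℓ) + Nat.log 2 q) * Estar := htotal
    _ ≤ (4 * C_T * C₂) * Lx ^ 3 * (y : ℝ) ^ (1 - α) * ζt ^ 2 * N ^ (2 * α) * ((y : ℝ) * (q : ℝ) ^ (1 - α)) +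
        (8 * C_E * C₂) * Lx ^ 3 * (y : ℝ) ^ (1 - α) * ζt ^ 2 * N ^ (2 * α) * ((U : ℝ) * (L * q) ^ (-α)) :=
        add_le_add hOD_le hE_le
    _ ≤ (4 * C_T * C₂ + 8 * C_E * C₂) * Lx ^ 3 * (y : ℝ) ^ (1 - α) * ζt ^ 2 * N ^ (2 * α) *
        ((y : ℝ) * (q : ℝ) ^ (1 - α) + (U : ℝ) * (L * q) ^ (-α)) := by
        have hK : 0 ≤ Lx ^ 3 * (y : ℝ) ^ (1 - α) * ζt ^ 2 * N ^ (2 * α) := by positivity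
        have h1 : 0 ≤ (y : ℝ) * (q : ℝ) ^ (1 - α) := by positivity
        have h2 : 0 ≤ (U : ℝ) * (L * q) ^ (-α) := by positivity
        have hA : 0 ≤ 4 * C_T * C₂ := by positivity
        have hB : 0 ≤ 8 * C_E * C₂ := by positivity
        have e1 : 0 ≤ (4 * C_T * C₂) * (Lx ^ 3 * (y : ℝ) ^ (1 - α) * ζt ^ 2 * N ^ (2 * α)) *
            ((U : ℝ) * (L * q) ^ (-α)) := mul_nonneg (mul_nonneg hA hK) h2
        have e2 : 0 ≤ (8 * C_E * C₂) * (Lx ^ 3 * (y : ℝ) ^ (1 - α) * ζt ^ 2 * N ^ (2 * α)) *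
            ((y : ℝ) * (q : ℝ) ^ (1 - α)) := mul_nonneg (mul_nonneg hB hK) h1
        nlinarith [e1, e2]

/-! ### Theorem 1 -/

set_option maxHeartbeats 3000000 in
-- a long assembly with a large context
/-- **Harper's Theorem 1** (minor-arc estimate for exponential sums over smooth numbers; our
form, reference scale `x`). There are `C, x₀` such that for `x ≥ x₀`, `(log x)^4 ≤ y`,
`log y ≤ (log x)^{1/6}`, `q ≥ 1`, `(a, q) = 1`, real `δ`, `L = 2(1 + |δ| x)` with `q² L² y³ ≤ x`:
`|∑_{n ≤ x, n ∈ S(y)} e(n(a/q + δ))| ≤ C (log x)³ y^{(5/2)(1−α)} (qL)^{−1/2 + (3/2)(1−α)} x^α ζ(α,y)/√φ₂(α,y)`,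
`α = α(x, y)` (and `x^α ζ/√φ₂ ≍ Ψ(x, y)` by `card_smoothNumbersUpTo_two_sided`).
[cite: Harper2016, Theorem 1 and §3] -/
theorem norm_smoothExpSum_le :
    ∃ C x₀ : ℝ, 0 < C ∧ ∀ (x : ℝ) (y : ℕ), x₀ ≤ x → Real.log x ^ 4 ≤ y →
      Real.log y ≤ Real.log x ^ (1 / 6 : ℝ) → ∀ (q : ℕ), 0 < q → ∀ (a : ℤ), IsCoprime a (q : ℤ) →
      ∀ (δ : ℝ), (q : ℝ) ^ 2 * (2 * (1 + |δ| * x)) ^ 2 * (y : ℝ) ^ 3 ≤ x →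
        ‖∑ n ∈ Nat.smoothNumbersUpTo ⌊x⌋₊ (y + 1), (𝐞 ((n : ℝ) * ((a : ℝ) / q + δ)) : ℂ)‖ ≤
          C * Real.log x ^ 3 * (y : ℝ) ^ (5 / 2 * (1 - saddlePoint x y)) *
            ((q : ℝ) * (2 * (1 + |δ| * x))) ^ (-(1 / 2 : ℝ) + 3 / 2 * (1 - saddlePoint x y)) *
            (x ^ saddlePoint x y *
              (smoothZeta (saddlePoint x y) y / Real.sqrt (saddlePhi₂ (saddlePoint x y) y))) := by
  classical
  obtain ⟨C₁, x₀P, hC₁, hPmain⟩ := sum_primes_geomBound_le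
  obtain ⟨C₂, x₀M, hC₂, hM⟩ := card_smoothNumbersUpTo_le_model_of_le
  obtain ⟨x₀F, h35⟩ := three_fifths_le_saddlePoint
  obtain ⟨x₀1, hlt1⟩ := saddlePoint_lt_one
  set X : ℝ := max (max x₀P x₀M) (max (max x₀F x₀1) (Real.exp 16)) with hXdef
  refine ⟨C₂ + 6 * Real.sqrt C₁, X, by positivity, fun x y hx hy4 hy6 q hq a hcop δ hH => ?_⟩
  have hx₀P : x₀P ≤ x := le_trans ((le_max_left _ _).trans (le_max_left _ _)) hx
  have hx₀M : x₀M ≤ x := le_trans ((le_max_right _ _).trans (le_max_left _ _)) hx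
  have hx₀F : x₀F ≤ x := le_trans (((le_max_left _ _).trans (le_max_left _ _)).trans (le_max_right _ _)) hx
  have hx₀1 : x₀1 ≤ x := le_trans (((le_max_right _ _).trans (le_max_left _ _)).trans (le_max_right _ _)) hx
  have hxe : Real.exp 16 ≤ x := le_trans ((le_max_right _ _).trans (le_max_right _ _)) hx
  ------------------------------------------------------------------
  -- ### the range
  set Lx := Real.log x with hLx
  have hLx16 : 16 ≤ Lx := by
    have := Real.log_le_log (Real.exp_pos _) hxe; rwa [Real.log_exp] at this
  have hx16 : (16 : ℝ) ≤ x := by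
    have h1 : (16 : ℝ) ≤ Real.exp 16 := by have := Real.add_one_le_exp (16 : ℝ); linarith
    exact h1.trans hxe
  have hx1 : 1 < x := by linarith
  have hx0 : 0 < x := by linarith
  have hLx1 : 1 ≤ Lx := by linarith
  have hyL : Lx ≤ y := by
    calc Lx = Lx ^ 1 := (pow_one _).symm
      _ ≤ Lx ^ 4 := pow_le_pow_right₀ hLx1 (by norm_num)
      _ ≤ y := hy4
  have hy16 : (16 : ℝ) ≤ y := by linarith
  have hy2 : 2 ≤ y := by exact_mod_cast (show (2 : ℝ) ≤ y by linarith)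
  have hy0 : (0 : ℝ) < y := by linarith
  have hy1 : (1 : ℝ) ≤ y := by linarith
  set ℓ := Real.log y with hℓ
  have hℓ0 : 0 < ℓ := Real.log_pos (by linarith)
  have hℓLx : ℓ ≤ Lx := by
    refine hy6.trans ?_
    calc Lx ^ (1 / 6 : ℝ) ≤ Lx ^ (1 : ℝ) := Real.rpow_le_rpow_of_exponent_le hLx1 (by norm_num)
      _ = Lx := Real.rpow_one _
  have hyx : (y : ℝ) ≤ x := by
    rw [← Real.exp_log hy0, ← Real.exp_log hx0]; exact Real.exp_le_exp.mpr hℓLx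
  have hy3 : Real.log x ^ 3 ≤ y := le_trans (pow_le_pow_right₀ hLx1 (by norm_num)) hy4
  set α := saddlePoint x y with hαdef
  have hα35 : 3 / 5 ≤ α := h35 x y hx₀F hy3 hyx
  have hα0 : 0 < α := by linarith
  have hα1 : α ≤ 1 := (hlt1 x y hx₀1 hy3 hyx hy6).le
  set ζt := smoothZeta α y / Real.sqrt (saddlePhi₂ α y) with hζt
  have hζt0 : 0 ≤ ζt := div_nonneg (smoothZeta_pos hα0).le (Real.sqrt_nonneg _)
  ------------------------------------------------------------------
  -- ### parameters
  set L := 2 * (1 + |δ| * x) with hL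
  have hδx0 : 0 ≤ |δ| * x := by positivity
  have hL2 : 2 ≤ L := by rw [hL]; linarith
  have hL1 : 1 ≤ L := by linarith
  have hL0 : 0 < L := by linarith
  have hq1 : (1 : ℝ) ≤ q := by exact_mod_cast hq
  have hq0 : (0 : ℝ) < q := by linarith
  set M := (q : ℝ) * L with hMdef
  have hM1 : 1 ≤ M := by rw [hMdef]; nlinarith
  have hM0 : 0 < M := by linarith
  have hqM : (q : ℝ) ≤ M := by rw [hMdef]; nlinarith
  set W := M * y with hW
  have hWq : W = (q : ℝ) * (2 * (1 + |δ| * x)) * y := by rw [hW, hMdef, hL]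
  have hW32 : 32 ≤ W := by rw [hW]; nlinarith
  have hW1 : 1 ≤ W := by linarith
  have hW0 : 0 < W := by linarith
  have hHW : W * (W * y) ≤ x := by
    have : W * (W * y) = (q : ℝ) ^ 2 * L ^ 2 * (y : ℝ) ^ 3 := by rw [hW, hMdef]; ring
    rw [this, hL]; exact hH
  set A := x / M with hA
  have hA0 : 0 < A := by positivity
  have hWA : W ≤ A := by
    rw [hA, le_div_iff₀ hM0]
    calc W * M ≤ W * (W * y) := by
          have : M ≤ W * y := by rw [hW]; nlinarith
          exact mul_le_mul_of_nonneg_left this hW0.le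
      _ ≤ x := hHW
  have hA1 : 1 ≤ A := hW1.trans hWA
  have hAx : A ≤ x := by rw [hA]; exact div_le_self hx0.le hM1
  set θ := (a : ℝ) / q + δ with hθ
  set e : ℝ := -(1 / 2 : ℝ) + 3 / 2 * (1 - α) with he
  -- the key quantity
  set K : ℝ := ζt * x ^ α * M ^ e * (y : ℝ) ^ (5 / 2 * (1 - α)) with hK
  have hK0 : 0 ≤ K := by positivity
  ------------------------------------------------------------------
  -- ### split at `A`
  rw [smoothNumbersUpTo_eq_union hAx, Finset.sum_union (by
    rw [Finset.disjoint_left]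
    intro n hn1 hn2
    rw [Nat.mem_smoothNumbersUpTo] at hn1
    rw [Finset.mem_filter, Finset.mem_Ioc] at hn2
    omega)]
  refine (norm_add_le _ _).trans ?_
  -- ### the short sum
  have hshort : ‖∑ n ∈ Nat.smoothNumbersUpTo ⌊A⌋₊ (y + 1), (𝐞 ((n : ℝ) * θ) : ℂ)‖ ≤ C₂ * K := by
    calc ‖∑ n ∈ Nat.smoothNumbersUpTo ⌊A⌋₊ (y + 1), (𝐞 ((n : ℝ) * θ) : ℂ)‖
        ≤ ∑ n ∈ Nat.smoothNumbersUpTo ⌊A⌋₊ (y + 1), ‖(𝐞 ((n : ℝ) * θ) : ℂ)‖ := norm_sum_le _ _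
      _ ≤ ∑ n ∈ Nat.smoothNumbersUpTo ⌊A⌋₊ (y + 1), (1 : ℝ) :=
          Finset.sum_le_sum fun n _ => (norm_fourierChar ((n : ℝ) * θ)).le
      _ = (Nat.smoothNumbersUpTo ⌊A⌋₊ (y + 1)).card := by
          rw [Finset.sum_const, nsmul_eq_mul, mul_one]
      _ ≤ C₂ * (A ^ α * smoothZeta α y / Real.sqrt (saddlePhi₂ α y)) := by
          have := hM x y hx₀M hy4 hy6 A hA1 hAx; rwa [← hαdef] at this
      _ = C₂ * (ζt * x ^ α * M ^ (-α)) := by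
          rw [hζt, hA, Real.div_rpow hx0.le hM0.le, Real.rpow_neg hM0.le]; ring
      _ ≤ C₂ * K := by
          apply mul_le_mul_of_nonneg_left _ hC₂.le
          rw [hK]
          have h1 : M ^ (-α) ≤ M ^ e := Real.rpow_le_rpow_of_exponent_le hM1 (by rw [he]; linarith)
          have h2 : (1 : ℝ) ≤ (y : ℝ) ^ (5 / 2 * (1 - α)) := Real.one_le_rpow hy1 (by nlinarith)
          calc ζt * x ^ α * M ^ (-α) ≤ ζt * x ^ α * M ^ e := by gcongr
            _ = ζt * x ^ α * M ^ e * 1 := (mul_one _).symm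
            _ ≤ ζt * x ^ α * M ^ e * (y : ℝ) ^ (5 / 2 * (1 - α)) := by gcongr
  -- ### the long sum: Cauchy–Schwarz reduction
  have hCS := norm_sum_smooth_fourierChar_le (x := x) (A := A) (W := W) (θ := θ) (y := y) hW1 hWA hAx hy2
  set u₀ : ℕ := ⌊W⌋₊ + 1 with hu₀
  have hu₀W : W < u₀ := by rw [hu₀]; push_cast; exact Nat.lt_floor_add_one W
  have hu₀0 : 0 < u₀ := by rw [hu₀]; omega
  -- per-class bound
  have hclass : ∀ j ∈ Finset.range (Nat.log 2 y + 1),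
      Real.sqrt (((prefixSet y W).filter (fun m => Nat.log 2 (m / (⌊W⌋₊ + 1)) = j)).card : ℝ) *
        Real.sqrt (∑ p ∈ (Finset.range (y + 1)).filter Nat.Prime,
          ∑ n₁ ∈ Nat.smoothNumbersUpTo ⌊x / (((⌊W⌋₊ + 1) * 2 ^ j : ℕ) : ℝ)⌋₊ (y + 1),
          ∑ n₂ ∈ Nat.smoothNumbersUpTo ⌊x / (((⌊W⌋₊ + 1) * 2 ^ j : ℕ) : ℝ)⌋₊ (y + 1),
            geomBound ((((⌊W⌋₊ + 1) * 2 ^ j : ℕ) : ℝ) / p + 1) ((p : ℝ) * ((n₁ : ℝ) - n₂) * θ)) ≤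
        2 * Real.sqrt C₁ * Lx ^ 2 * K := by
    intro j _
    set Mj := (prefixSet y W).filter (fun m => Nat.log 2 (m / (⌊W⌋₊ + 1)) = j) with hMj
    set U : ℕ := (⌊W⌋₊ + 1) * 2 ^ j with hU
    rcases Mj.eq_empty_or_nonempty with hemp | ⟨m, hm⟩
    · rw [hemp, Finset.card_empty, Nat.cast_zero, Real.sqrt_zero, zero_mul]; positivity
    -- a witness `m` gives `W ≤ U ≤ W y`
    rw [hMj, Finset.mem_filter, mem_prefixSet hW0.le] at hm
    obtain ⟨⟨hmW, hmWy, -, -⟩, hmj⟩ := hm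
    have hmu₀ : u₀ ≤ m := by
      have : ⌊W⌋₊ < m := (Nat.floor_lt hW0.le).mpr hmW
      rw [hu₀]; omega
    have hUm : U ≤ m := by
      have h1 : 2 ^ j ≤ m / u₀ := by
        rw [← hmj, hu₀]; exact Nat.pow_log_le_self 2 (Nat.div_pos hmu₀ hu₀0).ne'
      calc U = u₀ * 2 ^ j := by rw [hU, hu₀]
        _ ≤ u₀ * (m / u₀) := Nat.mul_le_mul_left _ h1
        _ ≤ m := Nat.mul_div_le m u₀
    have hm2U : m < 2 * U := by
      have h2 : m / u₀ < 2 ^ (j + 1) := by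
        rw [← hmj, hu₀]; exact Nat.lt_pow_succ_log_self one_lt_two _
      calc m < u₀ * (m / u₀ + 1) := by
            have := Nat.lt_div_mul_add (a := m) hu₀0
            linarith [Nat.div_add_mod m u₀, Nat.mod_lt m hu₀0]
        _ ≤ u₀ * 2 ^ (j + 1) := Nat.mul_le_mul_left _ h2
        _ = 2 * U := by rw [hU, hu₀, pow_succ]; ring
    have hUlo : W ≤ U := by
      have : (u₀ : ℝ) ≤ U := by
        rw [hU, hu₀]; push_cast
        have : (1 : ℝ) ≤ 2 ^ j := one_le_pow₀ (by norm_num)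
        nlinarith
      linarith
    have hUhi : (U : ℝ) ≤ W * y := le_trans (by exact_mod_cast hUm) hmWy
    have hU0 : (0 : ℝ) < U := by linarith
    -- `#Mj ≤ 2U`: all members are `< 2U`
    have hcard : (Mj.card : ℝ) ≤ 2 * U := by
      have hsub : Mj ⊆ Finset.range (2 * U) := by
        intro m' hm'
        rw [hMj, Finset.mem_filter, mem_prefixSet hW0.le] at hm'
        obtain ⟨⟨hm'W, -, -, -⟩, hm'j⟩ := hm'
        have hm'u₀ : u₀ ≤ m' := by
          have : ⌊W⌋₊ < m' := (Nat.floor_lt hW0.le).mpr hm'W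
          rw [hu₀]; omega
        have h2 : m' / u₀ < 2 ^ (j + 1) := by
          rw [← hm'j, hu₀]; exact Nat.lt_pow_succ_log_self one_lt_two _
        rw [Finset.mem_range]
        calc m' < u₀ * (m' / u₀ + 1) := by
              have := Nat.lt_div_mul_add (a := m') hu₀0
              linarith [Nat.div_add_mod m' u₀, Nat.mod_lt m' hu₀0]
          _ ≤ u₀ * 2 ^ (j + 1) := Nat.mul_le_mul_left _ h2
          _ = 2 * U := by rw [hU, hu₀, pow_succ]; ring
      have := Finset.card_le_card hsub
      rw [Finset.card_range] at this
      exact_mod_cast this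
    -- the sum over primes (T1)
    have hT1 := hPmain x y hx₀P hy4 hy6 q hq a hcop δ hH U (by rw [← hWq]; exact hUlo)
      (by rw [← hWq]; exact hUhi)
    rw [← hL, ← hαdef, ← hθ] at hT1
    -- `√#Mj √Σ ≤ √(2U · T1-bound) ≤ 2 √C₁ Lx² K`
    set N := x / (U : ℝ) with hN
    have hN0 : 0 < N := by positivity
    set T1b := C₁ * Lx ^ 3 * (y : ℝ) ^ (1 - α) * ζt ^ 2 * N ^ (2 * α) *
      ((y : ℝ) * (q : ℝ) ^ (1 - α) + (U : ℝ) * (L * q) ^ (-α)) with hT1b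
    have hT1b0 : 0 ≤ T1b := by positivity
    have hprod : 2 * (U : ℝ) * T1b ≤ (2 * Real.sqrt C₁ * Lx ^ 2 * K) ^ 2 := by
      -- exponent bookkeeping
      have hF1 : N ^ (2 * α) * U = x ^ (2 * α) * (U : ℝ) ^ (1 - 2 * α) := by
        rw [hN, Real.div_rpow hx0.le hU0.le, Real.rpow_sub hU0, Real.rpow_one]
        field_simp
      have hF2 : (U : ℝ) ^ (1 - 2 * α) ≤ W ^ (1 - 2 * α) :=
        Real.rpow_le_rpow_of_nonpos hW0 hUlo (by linarith)
      have hF3 : N ^ (2 * α) * (U : ℝ) ^ 2 = x ^ (2 * α) * (U : ℝ) ^ (2 - 2 * α) := by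
        rw [hN, Real.div_rpow hx0.le hU0.le, Real.rpow_sub hU0,
          show (U : ℝ) ^ (2 : ℝ) = (U : ℝ) ^ (2 : ℕ) by rw [← Real.rpow_natCast]; norm_num]
        field_simp
      have hF3' : (U : ℝ) ^ (2 - 2 * α) ≤ (W * y) ^ (2 - 2 * α) :=
        Real.rpow_le_rpow hU0.le hUhi (by linarith)
      -- `W^{1-2α} y q^{1-α} ≤ M^{2e} y^{2(1-α)}`
      have h2e : 2 * e = 2 - 3 * α := by rw [he]; ring
      have hF4 : W ^ (1 - 2 * α) * (y * (q : ℝ) ^ (1 - α)) ≤ M ^ (2 * e) * (y : ℝ) ^ (2 * (1 - α)) := by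
        rw [hW, Real.mul_rpow hM0.le hy0.le]
        have h1 : (q : ℝ) ^ (1 - α) ≤ M ^ (1 - α) := Real.rpow_le_rpow hq0.le hqM (by linarith)
        have h2 : M ^ (1 - 2 * α) * M ^ (1 - α) = M ^ (2 * e) := by
          rw [← Real.rpow_add hM0, h2e]; ring_nf
        have h3 : (y : ℝ) ^ (1 - 2 * α) * y = (y : ℝ) ^ (2 * (1 - α)) := by
          rw [show (y : ℝ) ^ (1 - 2 * α) * y = (y : ℝ) ^ (1 - 2 * α) * (y : ℝ) ^ (1 : ℝ) by rw [Real.rpow_one],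
            ← Real.rpow_add hy0]; ring_nf
        calc M ^ (1 - 2 * α) * (y : ℝ) ^ (1 - 2 * α) * (y * (q : ℝ) ^ (1 - α))
            = (M ^ (1 - 2 * α) * (q : ℝ) ^ (1 - α)) * ((y : ℝ) ^ (1 - 2 * α) * y) := by ring
          _ ≤ (M ^ (1 - 2 * α) * M ^ (1 - α)) * ((y : ℝ) ^ (1 - 2 * α) * y) := by gcongr
          _ = M ^ (2 * e) * (y : ℝ) ^ (2 * (1 - α)) := by rw [h2, h3]
      -- `(Wy)^{2-2α} (Lq)^{-α} = M^{2e} y^{4(1-α)}`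
      have hF5 : (W * y) ^ (2 - 2 * α) * (L * q) ^ (-α) = M ^ (2 * e) * (y : ℝ) ^ (4 * (1 - α)) := by
        rw [hW, show M * (y : ℝ) * y = M * ((y : ℝ) ^ (2 : ℕ)) by ring, Real.mul_rpow hM0.le (by positivity),
          show (L * q : ℝ) = M by rw [hMdef]; ring, ← Real.rpow_natCast, ← Real.rpow_mul hy0.le]
        rw [show M ^ (2 - 2 * α) * ((y : ℝ) ^ ((2 : ℕ) * (2 - 2 * α))) * M ^ (-α) =
          (M ^ (2 - 2 * α) * M ^ (-α)) * (y : ℝ) ^ ((2 : ℕ) * (2 - 2 * α)) by ring,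
          ← Real.rpow_add hM0, h2e]
        push_cast; ring_nf
      -- `y^{1-α}(y^{2(1-α)} + y^{4(1-α)}) ≤ 2 y^{5(1-α)}`
      have hF6 : (y : ℝ) ^ (1 - α) * ((y : ℝ) ^ (2 * (1 - α)) + (y : ℝ) ^ (4 * (1 - α))) ≤
          2 * (y : ℝ) ^ (5 * (1 - α)) := by
        rw [mul_add, ← Real.rpow_add hy0, ← Real.rpow_add hy0]
        have h1 : (y : ℝ) ^ (1 - α + 2 * (1 - α)) ≤ (y : ℝ) ^ (5 * (1 - α)) :=
          Real.rpow_le_rpow_of_exponent_le hy1 (by nlinarith)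
        have h2 : (y : ℝ) ^ (1 - α + 4 * (1 - α)) = (y : ℝ) ^ (5 * (1 - α)) := by ring_nf
        linarith
      -- squares
      have hsq : (2 * Real.sqrt C₁ * Lx ^ 2 * K) ^ 2 =
          4 * C₁ * Lx ^ 4 * (ζt ^ 2 * x ^ (2 * α) * M ^ (2 * e) * (y : ℝ) ^ (5 * (1 - α))) := by
        rw [hK]
        have h1 : Real.sqrt C₁ ^ 2 = C₁ := Real.sq_sqrt hC₁.le
        have h2 : (x ^ α) ^ 2 = x ^ (2 * α) := by rw [← Real.rpow_natCast, ← Real.rpow_mul hx0.le]; ring_nf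
        have h3 : (M ^ e) ^ 2 = M ^ (2 * e) := by rw [← Real.rpow_natCast, ← Real.rpow_mul hM0.le]; ring_nf
        have h4 : ((y : ℝ) ^ (5 / 2 * (1 - α))) ^ 2 = (y : ℝ) ^ (5 * (1 - α)) := by
          rw [← Real.rpow_natCast, ← Real.rpow_mul hy0.le]; ring_nf
        calc (2 * Real.sqrt C₁ * Lx ^ 2 * (ζt * x ^ α * M ^ e * (y : ℝ) ^ (5 / 2 * (1 - α)))) ^ 2
            = 4 * Real.sqrt C₁ ^ 2 * Lx ^ 4 * (ζt ^ 2 * (x ^ α) ^ 2 * (M ^ e) ^ 2 *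
                ((y : ℝ) ^ (5 / 2 * (1 - α))) ^ 2) := by ring
          _ = _ := by rw [h1, h2, h3, h4]
      rw [hsq]
      have hLx34 : Lx ^ 3 ≤ Lx ^ 4 := pow_le_pow_right₀ hLx1 (by norm_num)
      calc 2 * (U : ℝ) * T1b
          = 2 * C₁ * Lx ^ 3 * ζt ^ 2 * ((y : ℝ) ^ (1 - α) *
              ((N ^ (2 * α) * U) * (y * (q : ℝ) ^ (1 - α)) + (N ^ (2 * α) * (U : ℝ) ^ 2) * (L * q) ^ (-α))) := by
            rw [hT1b]; ring
        _ = 2 * C₁ * Lx ^ 3 * ζt ^ 2 * ((y : ℝ) ^ (1 - α) *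
              (x ^ (2 * α) * ((U : ℝ) ^ (1 - 2 * α) * (y * (q : ℝ) ^ (1 - α))) +
                x ^ (2 * α) * ((U : ℝ) ^ (2 - 2 * α) * (L * q) ^ (-α)))) := by rw [hF1, hF3]; ring
        _ ≤ 2 * C₁ * Lx ^ 3 * ζt ^ 2 * ((y : ℝ) ^ (1 - α) *
              (x ^ (2 * α) * (W ^ (1 - 2 * α) * (y * (q : ℝ) ^ (1 - α))) +
                x ^ (2 * α) * ((W * y) ^ (2 - 2 * α) * (L * q) ^ (-α)))) := by gcongr
        _ ≤ 2 * C₁ * Lx ^ 3 * ζt ^ 2 * ((y : ℝ) ^ (1 - α) *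
              (x ^ (2 * α) * (M ^ (2 * e) * (y : ℝ) ^ (2 * (1 - α))) +
                x ^ (2 * α) * (M ^ (2 * e) * (y : ℝ) ^ (4 * (1 - α))))) := by
            rw [hF5]; gcongr
        _ = 2 * C₁ * Lx ^ 3 * ζt ^ 2 * x ^ (2 * α) * M ^ (2 * e) *
              ((y : ℝ) ^ (1 - α) * ((y : ℝ) ^ (2 * (1 - α)) + (y : ℝ) ^ (4 * (1 - α)))) := by ring
        _ ≤ 2 * C₁ * Lx ^ 3 * ζt ^ 2 * x ^ (2 * α) * M ^ (2 * e) * (2 * (y : ℝ) ^ (5 * (1 - α))) := by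
            gcongr
        _ = 4 * C₁ * Lx ^ 3 * (ζt ^ 2 * x ^ (2 * α) * M ^ (2 * e) * (y : ℝ) ^ (5 * (1 - α))) := by ring
        _ ≤ 4 * C₁ * Lx ^ 4 * (ζt ^ 2 * x ^ (2 * α) * M ^ (2 * e) * (y : ℝ) ^ (5 * (1 - α))) := by
            gcongr
    calc Real.sqrt (Mj.card : ℝ) * Real.sqrt (∑ p ∈ (Finset.range (y + 1)).filter Nat.Prime,
          ∑ n₁ ∈ Nat.smoothNumbersUpTo ⌊x / (U : ℝ)⌋₊ (y + 1),
          ∑ n₂ ∈ Nat.smoothNumbersUpTo ⌊x / (U : ℝ)⌋₊ (y + 1),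
            geomBound ((U : ℝ) / p + 1) ((p : ℝ) * ((n₁ : ℝ) - n₂) * θ))
        ≤ Real.sqrt (2 * U) * Real.sqrt T1b := by
          apply mul_le_mul (Real.sqrt_le_sqrt hcard) (Real.sqrt_le_sqrt _) (Real.sqrt_nonneg _)
            (Real.sqrt_nonneg _)
          rw [hT1b, hN]; exact hT1
      _ = Real.sqrt (2 * U * T1b) := (Real.sqrt_mul (by positivity) _).symm
      _ ≤ Real.sqrt ((2 * Real.sqrt C₁ * Lx ^ 2 * K) ^ 2) := Real.sqrt_le_sqrt hprod
      _ = 2 * Real.sqrt C₁ * Lx ^ 2 * K := Real.sqrt_sq (by positivity)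
  -- sum over `j`
  have hJ : ((Nat.log 2 y : ℕ) : ℝ) + 1 ≤ 3 * Lx := by
    have h1 : (2 : ℝ) ^ (Nat.log 2 y) ≤ y := by exact_mod_cast Nat.pow_log_le_self 2 (by omega)
    have h2 : (Nat.log 2 y : ℝ) * Real.log 2 ≤ ℓ := by
      rw [← Real.log_pow, hℓ]; exact Real.log_le_log (by positivity) h1
    have hl2 : (1 : ℝ) / 2 < Real.log 2 := by have := Real.log_two_gt_d9; linarith
    nlinarith
  have hlong : ‖∑ n ∈ (Finset.Ioc ⌊A⌋₊ ⌊x⌋₊).filter (· ∈ Nat.smoothNumbers (y + 1)), (𝐞 ((n : ℝ) * θ) : ℂ)‖ ≤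
      (3 * Lx) * (2 * Real.sqrt C₁ * Lx ^ 2 * K) := by
    refine hCS.trans ((Finset.sum_le_sum hclass).trans ?_)
    rw [Finset.sum_const, Finset.card_range, nsmul_eq_mul]
    push_cast
    exact mul_le_mul_of_nonneg_right hJ (by positivity)
  -- ### assemble
  calc ‖∑ n ∈ Nat.smoothNumbersUpTo ⌊A⌋₊ (y + 1), (𝐞 ((n : ℝ) * θ) : ℂ)‖ +
        ‖∑ n ∈ (Finset.Ioc ⌊A⌋₊ ⌊x⌋₊).filter (· ∈ Nat.smoothNumbers (y + 1)), (𝐞 ((n : ℝ) * θ) : ℂ)‖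
      ≤ C₂ * K + (3 * Lx) * (2 * Real.sqrt C₁ * Lx ^ 2 * K) := add_le_add hshort hlong
    _ = (C₂ + 6 * Real.sqrt C₁ * Lx ^ 3) * K := by ring
    _ ≤ (C₂ + 6 * Real.sqrt C₁) * Lx ^ 3 * K := by
        have h1 : (1 : ℝ) ≤ Lx ^ 3 := one_le_pow₀ hLx1
        have h2 : C₂ ≤ C₂ * Lx ^ 3 := le_mul_of_one_le_right hC₂.le h1
        nlinarith [hK0, mul_nonneg hC₂.le hK0]
    _ = (C₂ + 6 * Real.sqrt C₁) * Lx ^ 3 * (y : ℝ) ^ (5 / 2 * (1 - α)) * M ^ e * (x ^ α * ζt) := by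
        rw [hK]; ring

end Literature.NumberTheory.Sieve

end
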